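import Summits.BirchSwinnertonDyer.Rank1Residual.X4.CharacterTwistTransport
import Summits.BirchSwinnertonDyer.Rank1Residual.X4.KuriharaAdditiveCertificateTwist
import HarnessLib

/-!
# The ADDITIVE (two-prime, `τ`-system) certificate transports along the twist by a character of ANY ORDER: the Hecke transform of a twisted sum with an inverse value, and the conductor-`p` (principal-series) template (cell `b2b-bsdres`, seat additive-p4, line V78)

HONEST FRAMING (verbatim, cell `b2b-bsdres`): the goal of the cell is to DELETE the COMBINATION-SHAPED
residual classes for ALL analytic-rank `≤ 1` curves over `ℚ` — "full BSD formula for every rank `≤ 1`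
curve in class `C`" assembled STRICTLY from published theorems — so that the rank-`≤ 1` remainder
becomes exactly the CONSTRUCTION-SHAPED classes, which are TYPED (missing-input Props), NOT attempted;
this is not "finishing BSD". This file: research-route KERNEL THEOREMS (pure algebra: transport of a
finite certificate along a character twist), 0 defs, 0 facts, nothing booked; X4 CONSTRUCTION-SHAPED.

## What is proved

`X4/KuriharaAdditiveCertificateTwist` transported the additive mod-`M` certificate
`PlusSymbolLevelLowersAdditivelyModAt W p f_W M ℓ₁ ℓ₂` along a QUADRATIC twist: the operator identity
`H_q(T_χμ) = χ(q)·T_χ(H_qμ)` and the sign rule `w ↦ wχ(ℓ)` both carry `χ(·)² = 1`.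
`X4/CharacterTwistTransport` (part 4b) removed the quadratic restriction for EIGEN data (inverse values
`c χ(k) = 1`, nebentypus bookkeeping). The additive certificate is made of NON-eigen derivative
families, so one needs the operator statement for a character of any order:

* §1 **`heckeTransform_twistSum_of_mul_eq_one`** (any commutative ring, modulus `m`,
  `χ : ℤ/m →* R`, `μ` periodic, `q ≠ 0` invertible mod `m`, `c χ(q) = 1`):
  `H_q(T_χμ)(r) = c · T_χ(H_qμ)(r) + (1 − c²) · T_χμ(qr)` — the two boundary terms `μ(qr + q²u/m)`
  and `μ(qr + u/m)` re-index with `c²` and `1`, leaving the defect `(1 − c²)T_χμ(qr)` (which is the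
  nebentypus `χ̄(q)²` of the twisted form, read on the `μ(q·)` term); `heckeTransform_twistSum_of_map_eq_one`:
  if `χ(q) = 1` then `H_q(T_χμ) = T_χ(H_qμ)` on the nose. The quadratic file's
  `heckeTransform_twistSum` is the case `c = χ(q)`, `χ(q)² = 1`.
* §2 **`plusSymbolLevelLowersAdditivelyModAt_of_charTwistSum`** — TRANSPORT TEMPLATE for the additive
  certificate along a twist by `χ : ℤ/m →* ℤ/M` of any order, under: the reduced plus symbol of `f_W`
  is `c₀ · T_χφ` (`hsym`); source-side families `Dα, Dβ, τ` (periodic) with Hecke-derivative relations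
  of eigenvalues `e_q` at the Kolyvagin primes `q` of `(W, p)`, where `q` is invertible mod `m` with an
  inverse value `c_q χ(q) = 1` such that `c_q² = 1` (the twisted form has trivial character AT `q`) and
  `c_q e_q ≡ a_q(W)`; the `τ`-identities with the source's signs `w₁, w₂` and the decomposition of `φ`;
  and at the two primes `ℓ_i`: invertible mod `m`, inverse values `c_i χ(ℓ_i) = 1` with `w_i c_i = 1`
  (NO condition on the order of `χ(ℓ_i)`). Witnesses: `D^W U = c₀ · (∏_{q∈U} c_q) · T_χ(D^{source} U)`.
  The quadratic file's `plusSymbolLevelLowersAdditivelyModAt_of_twistSum_fn` is the case `c_q = χ(q)`,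
  `c_i = χ(ℓ_i)`.
* §3 THE CONDUCTOR-`p` CASE **`plusSymbolLevelLowersAdditivelyModAt_of_charTwistSum_conductor`**
  (`m = p`, `χ : ℤ/p →* ℤ/M` of any order — the additive PRINCIPAL-SERIES shape, `e ∣ p − 1`): the
  Kolyvagin primes of `(W, p)` are `≡ 1 (mod p)`, so `χ(q) = 1` and `c_q = 1`
  (`X4/CharacterTwistTransport` §3): the source-side derivative relations are the PLAIN ones with
  eigenvalues `a_q(W)`, and the only visible effect of the character is at the two Tamagawa-defect
  primes: THE SIGNS ARE THE CHARACTER VALUES, `w_i = χ(ℓ_i)` (roots of unity of order dividing `e`).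
  Every consequence of `X4/KuriharaAdditiveCertificate` (`∂^{(∞)} ≥ e₁ + e₂`, the closures of
  `X4/KimDefectAdditiveLevelLowering`) then applies to `W` with a `τ`-system computed on the source.

Where the hypotheses come from (not asserted; none is in the tree for characters of order `> 2`):
`hsym` = Shimura 1971 Prop. 3.64 at the level of modular symbols for a newform `g` WITH NEBENTYPUS
(`f_W = g ⊗ χ̄`; the tree's `modularSymbol_charTwist` is the quadratic `Γ₀`-case) + `p`-adic
unit-ness of the period ratio; the source families = a `τ`-system for the reduction mod `𝔭 ∣ p` of
`g`'s symbol (an abstract function: no `Γ₁(M)`-symbols in the tree); `w_i = χ(ℓ_i)` = Ribet level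
lowering of `ρ̄_g = ρ̄_W ⊗ χ` at the split Tamagawa-defect primes `ℓ_i` of `W` (`a_{ℓ_i}(g) = χ(ℓ_i)`)
+ mod-`p` multiplicity one — per pair a certificate (EVIDENCE), never a fact. The cell's row of this
shape is 11760bb1 at `p = 7` (defect primes `3, 5`; `e = 3`; cubic `χ mod 7` with `χ(3), χ(5) ≠ 1`,
so the quadratic file does not apply); nothing about it is proved here.

## References

* B. Mazur, J. Tate, J. Teitelbaum, Invent. Math. 84 (1986), §I.4 (4.2), §I.8. [cite: MazurTateTeitelbaum1986Invent, §I.4 (4.2) and §I.8]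
* G. Shimura, *Introduction to the arithmetic theory of automorphic functions* (1971), Thm. 3.24,
  Prop. 3.64. [cite: Shimura1971, Prop. 3.64]
* C.-H. Kim, Amer. J. Math. 148 (2026), §1.2.2, §1.4.3, Conj. 1.10. [cite: Kim2022StructureSelmer, §1.2.2 and §1.4.3]
-/

noncomputable section

open scoped MatrixGroups ModularForm

open CongruenceSubgroup Finset

open Literature.NumberTheory.EllipticCurves Literature.NumberTheory.EllipticCurves.ModularForms

open Literature.NumberTheory.DiophantineGeometry.Dioph (ratModP)

namespace Summit.BirchSwinnertonDyer.Rank1Residual.LevelLowering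

/-! ### §1 The Hecke transform of a twisted sum, with an inverse value -/

section TwistAlgebra

variable {R : Type*} [CommRing R] {m : ℕ} [NeZero m] (χ : ZMod m →* R) {μ : ℚ → R}

/-- **`H_q(T_χμ)(r) = c · T_χ(H_qμ)(r) + (1 − c²) · T_χμ(qr)`** for `μ` periodic, `q ≠ 0` invertible
mod `m` and an inverse value `c χ(q) = 1` (character of ANY order): the Hecke sum of the twisted sum at
`r` is `∑_u χ(u)(H_qμ(r + q·u/m) − μ(qr + q²·u/m))`, the first part re-indexes with `c`
(`u ↦ qu`, `H_qμ` periodic), the second with `c²` (`u ↦ q²u`), and the boundary term `T_χμ(qr)` of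
`H_q(T_χμ)` survives with the coefficient `1 − c²` — the nebentypus `χ̄(q)²` of the twisted form.
The quadratic case (`c = χ(q)`, `c² = 1`) is `heckeTransform_twistSum`.
[cite: MazurTateTeitelbaum1986Invent, §I.4 (4.2) and §I.8] [cite: Shimura1971, Prop. 3.64] -/
theorem heckeTransform_twistSum_of_mul_eq_one (hμ : IsPeriodic μ) {q : ℕ} (hq0 : q ≠ 0)
    (hq : IsUnit ((q : ℕ) : ZMod m)) {c : R} (hc : c * χ q = 1) (r : ℚ) :
    heckeTransform q (fun s ↦ ∑ u : ZMod m, χ u * μ (s + (u.val : ℚ) / m)) r =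
      c * ∑ u : ZMod m, χ u * heckeTransform q μ (r + (u.val : ℚ) / m) +
        (1 - c ^ 2) * ∑ u : ZMod m, χ u * μ (q * r + (u.val : ℚ) / m) := by
  have hqQ : (q : ℚ) ≠ 0 := by exact_mod_cast hq0
  -- the Hecke transform of `μ` at the shifted points `r + q u/m`
  have hrow : ∀ u : ZMod m, ∑ j ∈ Finset.range q, μ ((r + j) / q + (u.val : ℚ) / m) =
      heckeTransform q μ (r + (q : ℚ) * u.val / m) - μ (q * r + ((q ^ 2 : ℕ) : ℚ) * u.val / m) := by
    intro u
    have e1 : ∀ j : ℕ, (r + (q : ℚ) * u.val / m + j) / q = (r + j) / q + (u.val : ℚ) / m := by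
      intro j; field_simp; ring
    have e2 : (q : ℚ) * (r + (q : ℚ) * u.val / m) = q * r + ((q ^ 2 : ℕ) : ℚ) * u.val / m := by
      push_cast; ring
    simp only [heckeTransform, e1, e2]
    ring
  have hperH : IsPeriodic (heckeTransform q μ) := hμ.heckeTransform' (Nat.pos_of_ne_zero hq0)
  have hunit2 : IsUnit (((q ^ 2 : ℕ) : ℕ) : ZMod m) := by
    rw [Nat.cast_pow]; exact hq.pow 2
  have hc2 : c ^ 2 * χ ((q ^ 2 : ℕ) : ZMod m) = 1 := by
    rw [Nat.cast_pow, map_pow, ← mul_pow, hc, one_pow]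
  -- unfold the outer transform and exchange the sums
  show (∑ j ∈ Finset.range q, ∑ u : ZMod m, χ u * μ ((r + j) / q + (u.val : ℚ) / m)) +
      ∑ u : ZMod m, χ u * μ (q * r + (u.val : ℚ) / m) =
    c * ∑ u : ZMod m, χ u * heckeTransform q μ (r + (u.val : ℚ) / m) +
      (1 - c ^ 2) * ∑ u : ZMod m, χ u * μ (q * r + (u.val : ℚ) / m)
  rw [Finset.sum_comm]
  simp_rw [← Finset.mul_sum, hrow, mul_sub, Finset.sum_sub_distrib]
  have hA : ∑ u : ZMod m, χ u * heckeTransform q μ (r + (q : ℚ) * u.val / m) =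
      c * ∑ u : ZMod m, χ u * heckeTransform q μ (r + (u.val : ℚ) / m) :=
    twistSum_natMul_of_mul_eq_one χ hperH hq hc r
  have hB : ∑ u : ZMod m, χ u * μ (q * r + ((q ^ 2 : ℕ) : ℚ) * u.val / m) =
      c ^ 2 * ∑ u : ZMod m, χ u * μ (q * r + (u.val : ℚ) / m) :=
    twistSum_natMul_of_mul_eq_one χ hμ hunit2 hc2 (q * r)
  rw [hA, hB]
  ring

/-- **`H_q(T_χμ) = T_χ(H_qμ)` on the nose when `χ(q) = 1`** (inverse value `c = 1`, no boundary
defect) — the case of EVERY Kolyvagin prime for a character of conductor `p` (§3).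
[cite: MazurTateTeitelbaum1986Invent, §I.4 (4.2) and §I.8] -/
theorem heckeTransform_twistSum_of_map_eq_one (hμ : IsPeriodic μ) {q : ℕ} (hq0 : q ≠ 0)
    (hq : IsUnit ((q : ℕ) : ZMod m)) (hχq : χ q = 1) (r : ℚ) :
    heckeTransform q (fun s ↦ ∑ u : ZMod m, χ u * μ (s + (u.val : ℚ) / m)) r =
      ∑ u : ZMod m, χ u * heckeTransform q μ (r + (u.val : ℚ) / m) := by
  have h := heckeTransform_twistSum_of_mul_eq_one χ hμ hq0 hq (c := 1) (by rw [one_mul, hχq]) r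
  rw [one_pow, sub_self, zero_mul, add_zero, one_mul] at h
  exact h

end TwistAlgebra

/-! ### §2 Transport of the additive certificate along a twist by a character of any order -/

section TransportFn

variable (W : WeierstrassCurve ℚ) [W.IsGloballyMinimal] (p : ℕ) {M : ℕ}
  {m : ℕ} [NeZero m] (χ : ZMod m →* ZMod M) {NW : ℕ} (fW : CuspForm (Gamma0 NW) 2)

/-- **TRANSPORT OF THE ADDITIVE MOD-`M` CERTIFICATE ALONG A TWIST BY A CHARACTER OF ANY ORDER
(template).** Data: the reduced plus symbol of `f_W` is `c₀` times the `χ`-twisted sum of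
`φ : ℚ → ℤ/M` (`hsym`); source-side families `Dα, Dβ, τ` (periodic) with the Hecke-derivative
relations of eigenvalues `e_q` at the Kolyvagin primes `q` of `(W, p)`, `q` invertible mod `m` with an
inverse value `c_q χ(q) = 1`, `c_q² = 1` and `c_q e_q = a_q(W) mod M` (`hq`); the `τ`-identities with
the source's signs, `Dα U = τ_U − w₂τ_U∘[ℓ₂]`, `Dβ U = −(τ_U − w₁τ_U∘[ℓ₁])` (`U ≠ ∅`); the
decomposition `φ = (Dα ∅ − w₁Dα ∅∘[ℓ₁]) + (Dβ ∅ − w₂Dβ ∅∘[ℓ₂])`; and `ℓ_i` invertible mod `m` with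
inverse values `c_i χ(ℓ_i) = 1`, `w_i c_i = 1` — no hypothesis on the order of `χ`. THEN
`PlusSymbolLevelLowersAdditivelyModAt W p f_W M ℓ₁ ℓ₂`, with the witnesses
`D^W U = c₀·(∏_{q∈U} c_q)·T_χ(D U)` (§1: each derivative acquires a `c_q`, absorbed by the product;
part 4b's `twistSum_oldform_of_mul_eq_one`: the signs `w_i` become `w_i c_i = 1`).
[cite: Kim2022StructureSelmer, §1.2.2 and §1.4.3] [cite: MazurTateTeitelbaum1986Invent, §I.4 (4.2) and §I.8] -/
theorem plusSymbolLevelLowersAdditivelyModAt_of_charTwistSum (c₀ : ZMod M) (φ : ℚ → ZMod M)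
    (hsym : ∀ r : ℚ, ratModP M (ratPlusSymbol fW r) =
      c₀ * ∑ u : ZMod m, χ u * φ (r + (u.val : ℚ) / m))
    {ℓ₁ ℓ₂ : ℕ} (Dα Dβ τ : Finset ℕ → ℚ → ZMod M)
    (hpα : ∀ U, IsPeriodic (Dα U)) (hpβ : ∀ U, IsPeriodic (Dβ U)) (hpτ : ∀ U, IsPeriodic (τ U))
    (e cq : ℕ → ZMod M)
    (hq : ∀ q : ℕ, Kato.IsKolyvaginPrime W p 1 q →
      IsUnit ((q : ℕ) : ZMod m) ∧ cq q * χ q = 1 ∧ cq q ^ 2 = 1 ∧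
        cq q * e q = (W.frobeniusTrace q : ZMod M))
    (hDα : ∀ (U : Finset ℕ) (q : ℕ), Kato.IsKolyvaginPrime W p 1 q → q ∉ U → ∀ r : ℚ,
      heckeTransform q (Dα U) r = e q * Dα U r + Dα (insert q U) r)
    (hDβ : ∀ (U : Finset ℕ) (q : ℕ), Kato.IsKolyvaginPrime W p 1 q → q ∉ U → ∀ r : ℚ,
      heckeTransform q (Dβ U) r = e q * Dβ U r + Dβ (insert q U) r)
    (hDτ : ∀ (U : Finset ℕ), U.Nonempty → ∀ (q : ℕ), Kato.IsKolyvaginPrime W p 1 q → q ∉ U →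
      ∀ r : ℚ, heckeTransform q (τ U) r = e q * τ U r + τ (insert q U) r)
    {w₁ w₂ : ZMod M}
    (h1 : ∀ U : Finset ℕ, U.Nonempty → (∀ q ∈ U, Kato.IsKolyvaginPrime W p 1 q) →
      ∀ r : ℚ, Dα U r = τ U r - w₂ * τ U (ℓ₂ * r))
    (h2 : ∀ U : Finset ℕ, U.Nonempty → (∀ q ∈ U, Kato.IsKolyvaginPrime W p 1 q) →
      ∀ r : ℚ, Dβ U r = -(τ U r - w₁ * τ U (ℓ₁ * r)))
    (hV : ∀ r : ℚ, φ r = (Dα ∅ r - w₁ * Dα ∅ (ℓ₁ * r)) + (Dβ ∅ r - w₂ * Dβ ∅ (ℓ₂ * r)))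
    {c₁ c₂ : ZMod M}
    (hℓ₁ : IsUnit ((ℓ₁ : ℕ) : ZMod m) ∧ c₁ * χ ℓ₁ = 1 ∧ w₁ * c₁ = 1)
    (hℓ₂ : IsUnit ((ℓ₂ : ℕ) : ZMod m) ∧ c₂ * χ ℓ₂ = 1 ∧ w₂ * c₂ = 1) :
    PlusSymbolLevelLowersAdditivelyModAt W p fW M ℓ₁ ℓ₂ := by
  classical
  -- periodicity of the transported families `D^W U = c₀ · (∏ c_q) · T_χ(D U)`
  have hperT : ∀ D : Finset ℕ → ℚ → ZMod M, (∀ U, IsPeriodic (D U)) → ∀ U : Finset ℕ,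
      IsPeriodic (fun s ↦ c₀ * (∏ q ∈ U, cq q) * ∑ u : ZMod m, χ u * D U (s + (u.val : ℚ) / m)) := by
    intro D hD U r z
    have hper := isPeriodic_twistSum χ (hD U) r z
    simp only at hper ⊢
    rw [hper]
  -- derivative relations of the transported families
  have hderT : ∀ (D : Finset ℕ → ℚ → ZMod M), (∀ U, IsPeriodic (D U)) →
      ∀ (U : Finset ℕ) (q : ℕ), Kato.IsKolyvaginPrime W p 1 q → q ∉ U →
      (∀ r : ℚ, heckeTransform q (D U) r = e q * D U r + D (insert q U) r) →
      ∀ r : ℚ, heckeTransform q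
          (fun s ↦ c₀ * (∏ q' ∈ U, cq q') * ∑ u : ZMod m, χ u * D U (s + (u.val : ℚ) / m)) r =
        (W.frobeniusTrace q : ZMod M) *
            (c₀ * (∏ q' ∈ U, cq q') * ∑ u : ZMod m, χ u * D U (r + (u.val : ℚ) / m)) +
          c₀ * (∏ q' ∈ insert q U, cq q') *
            ∑ u : ZMod m, χ u * D (insert q U) (r + (u.val : ℚ) / m) := by
    intro D hD U q hKq hqU hrel r
    obtain ⟨hqu, hcq, hcq2, haq⟩ := hq q hKq
    have hfun : (fun s ↦ c₀ * (∏ q' ∈ U, cq q') * ∑ u : ZMod m, χ u * D U (s + (u.val : ℚ) / m)) =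
        fun s ↦ (c₀ * ∏ q' ∈ U, cq q') *
          (fun s' ↦ ∑ u : ZMod m, χ u * D U (s' + (u.val : ℚ) / m)) s := by
      funext s; ring
    have hsum : ∑ u : ZMod m, χ u * heckeTransform q (D U) (r + (u.val : ℚ) / m) =
        e q * ∑ u : ZMod m, χ u * D U (r + (u.val : ℚ) / m) +
          ∑ u : ZMod m, χ u * D (insert q U) (r + (u.val : ℚ) / m) := by
      rw [Finset.mul_sum, ← Finset.sum_add_distrib]
      exact Finset.sum_congr rfl fun u _ ↦ by rw [hrel]; ring
    rw [hfun, heckeTransform_const_mul,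
      heckeTransform_twistSum_of_mul_eq_one χ (hD U) hKq.prime.ne_zero hqu hcq r, hcq2, sub_self,
      zero_mul, add_zero, hsum, Finset.prod_insert hqU, ← haq]
    ring
  refine ⟨fun U s ↦ c₀ * (∏ q ∈ U, cq q) * ∑ u : ZMod m, χ u * Dα U (s + (u.val : ℚ) / m),
    fun U s ↦ c₀ * (∏ q ∈ U, cq q) * ∑ u : ZMod m, χ u * Dβ U (s + (u.val : ℚ) / m),
    fun U s ↦ c₀ * (∏ q ∈ U, cq q) * ∑ u : ZMod m, χ u * τ U (s + (u.val : ℚ) / m),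
    hperT Dα hpα, hperT Dβ hpβ, hperT τ hpτ,
    fun U q hKq hqU ↦ hderT Dα hpα U q hKq hqU (hDα U q hKq hqU),
    fun U q hKq hqU ↦ hderT Dβ hpβ U q hKq hqU (hDβ U q hKq hqU),
    fun U hU q hKq hqU ↦ hderT τ hpτ U q hKq hqU (hDτ U hU q hKq hqU), ?_, ?_, ?_⟩
  · -- `Dα^W U = τ^W_U − τ^W_U∘[ℓ₂]`
    intro U hU hUK r
    obtain ⟨hu2, hc2, hw2⟩ := hℓ₂
    have h := twistSum_oldform_of_mul_eq_one χ (hpτ U) (φ := Dα U) hu2 hc2 (h1 U hU hUK) r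
    simp only
    rw [h, hw2, one_mul]
    ring
  · -- `Dβ^W U = −(τ^W_U − τ^W_U∘[ℓ₁])`
    intro U hU hUK r
    obtain ⟨hu1, hc1, hw1⟩ := hℓ₁
    have hneg : ∀ s : ℚ, (fun x ↦ -Dβ U x) s = τ U s - w₁ * τ U (ℓ₁ * s) := by
      intro s; simp only [h2 U hU hUK s, neg_neg]
    have h := twistSum_oldform_of_mul_eq_one χ (hpτ U) (φ := fun x ↦ -Dβ U x) hu1 hc1 hneg r
    have hlin : ∑ u : ZMod m, χ u * (fun x ↦ -Dβ U x) (r + (u.val : ℚ) / m) =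
        -∑ u : ZMod m, χ u * Dβ U (r + (u.val : ℚ) / m) := by
      rw [← Finset.sum_neg_distrib]
      exact Finset.sum_congr rfl fun u _ ↦ by simp only [mul_neg]
    rw [hlin, hw1, one_mul] at h
    have h' : ∑ u : ZMod m, χ u * Dβ U (r + (u.val : ℚ) / m) =
        -(∑ u : ZMod m, χ u * τ U (r + (u.val : ℚ) / m) -
          ∑ u : ZMod m, χ u * τ U (ℓ₁ * r + (u.val : ℚ) / m)) := by
      rw [← h, neg_neg]
    simp only
    rw [h']
    ring
  · -- the decomposition of the plus symbol of `f_W`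
    intro r
    obtain ⟨hu1, hc1, hw1⟩ := hℓ₁
    obtain ⟨hu2, hc2, hw2⟩ := hℓ₂
    have hA := twistSum_oldform_of_mul_eq_one χ (hpα ∅)
      (φ := fun x ↦ Dα ∅ x - w₁ * Dα ∅ (ℓ₁ * x)) hu1 hc1 (fun _ ↦ rfl) r
    have hB := twistSum_oldform_of_mul_eq_one χ (hpβ ∅)
      (φ := fun x ↦ Dβ ∅ x - w₂ * Dβ ∅ (ℓ₂ * x)) hu2 hc2 (fun _ ↦ rfl) r
    have hsum : ∑ u : ZMod m, χ u * φ (r + (u.val : ℚ) / m) =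
        ∑ u : ZMod m, χ u * (Dα ∅ (r + (u.val : ℚ) / m) - w₁ * Dα ∅ (ℓ₁ * (r + (u.val : ℚ) / m))) +
          ∑ u : ZMod m, χ u *
            (Dβ ∅ (r + (u.val : ℚ) / m) - w₂ * Dβ ∅ (ℓ₂ * (r + (u.val : ℚ) / m))) := by
      rw [← Finset.sum_add_distrib]
      exact Finset.sum_congr rfl fun u _ ↦ by rw [hV]; ring
    simp only [Finset.prod_empty]
    rw [hsym r, hsum, hA, hB, hw1, hw2]
    ring

end TransportFn

/-! ### §3 The conductor-`p` case: plain derivative relations, signs = character values -/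

section Conductor

variable (W : WeierstrassCurve ℚ) [W.IsGloballyMinimal] (p : ℕ) [hp : Fact p.Prime] {M : ℕ}
  (χ : ZMod p →* ZMod M) {NW : ℕ} (fW : CuspForm (Gamma0 NW) 2)

/-- **THE PRINCIPAL-SERIES TEMPLATE FOR THE ADDITIVE CERTIFICATE (conductor `p`).** For a character
`χ : ℤ/p →* ℤ/M` of ANY order, the additive mod-`M` certificate of `W` at the primes `ℓ₁, ℓ₂`
(`p ∤ ℓ_i`) follows from: the twisted-sum identity for the reduced plus symbol of `f_W`,
`\overline{[r]⁺_{f_W}} = c₀ ∑_{u mod p} χ(u) φ(r + u/p)` (`hsym`); source-side families `Dα, Dβ, τ`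
(periodic) with the PLAIN Hecke-derivative relations of eigenvalues `a_q(W) mod M` at the Kolyvagin
primes of `(W, p)` (there `q ≡ 1 (mod p)`, so `χ(q) = 1`: no twist factor, no nebentypus); the
`τ`-identities and the decomposition of `φ` with the signs EQUAL TO THE CHARACTER VALUES,
`w₁ = χ(ℓ₁)`, `w₂ = χ(ℓ₂)`. THEN `PlusSymbolLevelLowersAdditivelyModAt W p f_W M ℓ₁ ℓ₂`
(§2 with `c_q = 1` and `c_i = χ(ℓ_i⁻¹)`).
[cite: Kim2022StructureSelmer, §1.2.2 and §1.4.3] [cite: MazurTateTeitelbaum1986Invent, §I.4 (4.2) and §I.8] -/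
theorem plusSymbolLevelLowersAdditivelyModAt_of_charTwistSum_conductor (c₀ : ZMod M) (φ : ℚ → ZMod M)
    (hsym : ∀ r : ℚ, ratModP M (ratPlusSymbol fW r) =
      c₀ * ∑ u : ZMod p, χ u * φ (r + (u.val : ℚ) / p))
    {ℓ₁ ℓ₂ : ℕ} (hℓ₁ : ¬ p ∣ ℓ₁) (hℓ₂ : ¬ p ∣ ℓ₂) (Dα Dβ τ : Finset ℕ → ℚ → ZMod M)
    (hpα : ∀ U, IsPeriodic (Dα U)) (hpβ : ∀ U, IsPeriodic (Dβ U)) (hpτ : ∀ U, IsPeriodic (τ U))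
    (hDα : ∀ (U : Finset ℕ) (q : ℕ), Kato.IsKolyvaginPrime W p 1 q → q ∉ U → ∀ r : ℚ,
      heckeTransform q (Dα U) r = (W.frobeniusTrace q : ZMod M) * Dα U r + Dα (insert q U) r)
    (hDβ : ∀ (U : Finset ℕ) (q : ℕ), Kato.IsKolyvaginPrime W p 1 q → q ∉ U → ∀ r : ℚ,
      heckeTransform q (Dβ U) r = (W.frobeniusTrace q : ZMod M) * Dβ U r + Dβ (insert q U) r)
    (hDτ : ∀ (U : Finset ℕ), U.Nonempty → ∀ (q : ℕ), Kato.IsKolyvaginPrime W p 1 q → q ∉ U →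
      ∀ r : ℚ, heckeTransform q (τ U) r = (W.frobeniusTrace q : ZMod M) * τ U r + τ (insert q U) r)
    (h1 : ∀ U : Finset ℕ, U.Nonempty → (∀ q ∈ U, Kato.IsKolyvaginPrime W p 1 q) →
      ∀ r : ℚ, Dα U r = τ U r - χ ℓ₂ * τ U (ℓ₂ * r))
    (h2 : ∀ U : Finset ℕ, U.Nonempty → (∀ q ∈ U, Kato.IsKolyvaginPrime W p 1 q) →
      ∀ r : ℚ, Dβ U r = -(τ U r - χ ℓ₁ * τ U (ℓ₁ * r)))
    (hV : ∀ r : ℚ, φ r =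
      (Dα ∅ r - χ ℓ₁ * Dα ∅ (ℓ₁ * r)) + (Dβ ∅ r - χ ℓ₂ * Dβ ∅ (ℓ₂ * r))) :
    PlusSymbolLevelLowersAdditivelyModAt W p fW M ℓ₁ ℓ₂ := by
  have hℓ10 : ((ℓ₁ : ℕ) : ZMod p) ≠ 0 := mt (ZMod.natCast_eq_zero_iff _ _).mp hℓ₁
  have hℓ20 : ((ℓ₂ : ℕ) : ZMod p) ≠ 0 := mt (ZMod.natCast_eq_zero_iff _ _).mp hℓ₂
  -- the inverse values at `ℓ_i` are `χ(ℓ_i⁻¹)`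
  have hc1 : χ ((ℓ₁ : ZMod p)⁻¹) * χ ℓ₁ = 1 := by
    rw [← map_mul, inv_mul_cancel₀ hℓ10, map_one]
  have hc2 : χ ((ℓ₂ : ZMod p)⁻¹) * χ ℓ₂ = 1 := by
    rw [← map_mul, inv_mul_cancel₀ hℓ20, map_one]
  have hw1 : χ ℓ₁ * χ ((ℓ₁ : ZMod p)⁻¹) = 1 := by
    rw [← map_mul, mul_inv_cancel₀ hℓ10, map_one]
  have hw2 : χ ℓ₂ * χ ((ℓ₂ : ZMod p)⁻¹) = 1 := by
    rw [← map_mul, mul_inv_cancel₀ hℓ20, map_one]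
  refine plusSymbolLevelLowersAdditivelyModAt_of_charTwistSum W p χ fW c₀ φ hsym Dα Dβ τ hpα hpβ hpτ
    (fun q ↦ (W.frobeniusTrace q : ZMod M)) (fun _ ↦ 1) (fun q hKq ↦ ?_) hDα hDβ hDτ h1 h2 hV
    ⟨hℓ10.isUnit, hc1, hw1⟩ ⟨hℓ20.isUnit, hc2, hw2⟩
  have hq1 : (q : ZMod p) = 1 := natCast_zmod_eq_one_of_isKolyvaginPrime W p hKq
  refine ⟨?_, ?_, ?_, ?_⟩
  · rw [hq1]; exact isUnit_one
  · rw [one_mul, hq1, map_one]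
  · rw [one_pow]
  · rw [one_mul]

end Conductor

end Summit.BirchSwinnertonDyer.Rank1Residual.LevelLowering

end
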